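import Literature.NumberTheory.LFunctions.FordProgram1Run01
import Literature.NumberTheory.LFunctions.FordProgram1Run02
import Literature.NumberTheory.LFunctions.FordProgram1Run03A
import Literature.NumberTheory.LFunctions.FordProgram1Run03B
import Literature.NumberTheory.LFunctions.FordProgram1Run03C
import Literature.NumberTheory.LFunctions.FordProgram1Run04A
import Literature.NumberTheory.LFunctions.FordProgram1Run04B
import Literature.NumberTheory.LFunctions.FordProgram1Run04C
import Literature.NumberTheory.LFunctions.FordProgram1Run05
import Literature.NumberTheory.LFunctions.FordProgram1Run06
import Literature.NumberTheory.LFunctions.FordProgram1Run07A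
import Literature.NumberTheory.LFunctions.FordProgram1Run07B
import Literature.NumberTheory.LFunctions.FordProgram1Run07C
import Literature.NumberTheory.LFunctions.FordProgram1Run08A
import Literature.NumberTheory.LFunctions.FordProgram1Run08B
import Literature.NumberTheory.LFunctions.FordProgram1Run08C
import Literature.NumberTheory.LFunctions.FordProgram1Run09
import Literature.NumberTheory.LFunctions.FordProgram1Run10
import Literature.NumberTheory.LFunctions.FordProgram1Run11A
import Literature.NumberTheory.LFunctions.FordProgram1Run11B
import Literature.NumberTheory.LFunctions.FordProgram1Run11C
import Literature.NumberTheory.LFunctions.FordProgram1Run12A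
import Literature.NumberTheory.LFunctions.FordProgram1Run12B
import Literature.NumberTheory.LFunctions.FordProgram1Run12C
import Literature.NumberTheory.LFunctions.FordProgram1Run13A
import Literature.NumberTheory.LFunctions.FordProgram1Run13B
import Literature.NumberTheory.LFunctions.FordProgram1Run13C
import Literature.NumberTheory.LFunctions.FordProgram1Run14A
import Literature.NumberTheory.LFunctions.FordProgram1Run14B
import Literature.NumberTheory.LFunctions.FordProgram1Run14C
import Literature.NumberTheory.LFunctions.FordProgram1Run15A
import Literature.NumberTheory.LFunctions.FordProgram1Run15B
import Literature.NumberTheory.LFunctions.FordProgram1Run15C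
import Literature.NumberTheory.LFunctions.FordProgram1Run16
import Literature.NumberTheory.LFunctions.FordProgram1Run17
import Literature.NumberTheory.LFunctions.FordProgram1Run18
import Literature.NumberTheory.LFunctions.FordProgram1Run19A
import Literature.NumberTheory.LFunctions.FordProgram1Run19B
import Literature.NumberTheory.LFunctions.FordProgram1Run19C
import Literature.NumberTheory.LFunctions.FordProgram1Run20A
import Literature.NumberTheory.LFunctions.FordProgram1Run20B
import Literature.NumberTheory.LFunctions.FordProgram1Run20C
import Literature.NumberTheory.LFunctions.FordProgram1Run21
import Literature.NumberTheory.LFunctions.FordProgram1Run22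
import Literature.NumberTheory.LFunctions.FordProgram1Run23A
import Literature.NumberTheory.LFunctions.FordProgram1Run23B
import Literature.NumberTheory.LFunctions.FordProgram1Run23C
import Literature.NumberTheory.LFunctions.FordProgram1Run24A
import Literature.NumberTheory.LFunctions.FordProgram1Run24B
import Literature.NumberTheory.LFunctions.FordProgram1Run24C
import Literature.NumberTheory.LFunctions.FordProgram1Run25A
import Literature.NumberTheory.LFunctions.FordProgram1Run25B
import Literature.NumberTheory.LFunctions.FordProgram1Run25C
import Literature.NumberTheory.LFunctions.FordProgram1Run26
import Literature.NumberTheory.LFunctions.FordProgram1Run27A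
import Literature.NumberTheory.LFunctions.FordProgram1Run27B
import Literature.NumberTheory.LFunctions.FordProgram1Run27C
import Literature.NumberTheory.LFunctions.FordProgram1Run28
import Literature.NumberTheory.LFunctions.FordProgram1Run29A
import Literature.NumberTheory.LFunctions.FordProgram1Run29B
import Literature.NumberTheory.LFunctions.FordProgram1Run29C
import Literature.NumberTheory.LFunctions.FordProgram1Run30A
import Literature.NumberTheory.LFunctions.FordProgram1Run30B
import Literature.NumberTheory.LFunctions.FordProgram1Run30C
import Literature.NumberTheory.LFunctions.FordProgram1Run31A
import Literature.NumberTheory.LFunctions.FordProgram1Run31B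
import Literature.NumberTheory.LFunctions.FordProgram1Run31C
import Literature.NumberTheory.LFunctions.FordProgram1Run32A
import Literature.NumberTheory.LFunctions.FordProgram1Run32B
import Literature.NumberTheory.LFunctions.FordProgram1Run32C
import Literature.NumberTheory.LFunctions.FordProgram1Run33
import Literature.NumberTheory.LFunctions.FordProgram1Run34A
import Literature.NumberTheory.LFunctions.FordProgram1Run34B
import Literature.NumberTheory.LFunctions.FordProgram1Run34C
import Literature.NumberTheory.LFunctions.FordProgram1Run35
import Literature.NumberTheory.LFunctions.FordProgram1Run36A
import Literature.NumberTheory.LFunctions.FordProgram1Run36B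
import Literature.NumberTheory.LFunctions.FordProgram1Run36C
import Literature.NumberTheory.LFunctions.FordProgram1Run37A
import Literature.NumberTheory.LFunctions.FordProgram1Run37B
import Literature.NumberTheory.LFunctions.FordProgram1Run37C
import Literature.NumberTheory.LFunctions.FordProgram1Run38A
import Literature.NumberTheory.LFunctions.FordProgram1Run38B
import Literature.NumberTheory.LFunctions.FordProgram1Run38C
import Literature.NumberTheory.LFunctions.FordProgram1Run39A
import Literature.NumberTheory.LFunctions.FordProgram1Run39B
import Literature.NumberTheory.LFunctions.FordProgram1Run39C
import Literature.NumberTheory.LFunctions.FordProgram1Run40A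
import Literature.NumberTheory.LFunctions.FordProgram1Run40B
import Literature.NumberTheory.LFunctions.FordProgram1Run40C
import Literature.NumberTheory.LFunctions.FordProgram1Run41
import Literature.NumberTheory.LFunctions.FordProgram1Run42
import HarnessLib

/-!
# Ford's Theorem 3, second part: the rows of (1.7) for `129 ≤ k ≤ 1190` from Lemma 3.4

Topic `Literature/NumberTheory/LFunctions`. Everything here is PROVED; no named fact is introduced.

K. Ford, Proc. LMS 85 (2002), Theorem 3 with (1.7): for `129 ≤ k` there is `s ≤ ρk²` with
`J_{s,k}(P) ≤ k^{θk³} P^{2s − k(k+1)/2 + k²/1000}` (`P ≥ 1`), where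
`(ρ, θ) = (3.22313, 2.4183)` for `129 ≤ k ≤ 149`, `(3.21734, 2.3849)` for `150 ≤ k ≤ 199`,
`(3.21432, 2.3291)` for `k ≥ 200`. This file proves the rows for `129 ≤ k ≤ 1190` **from Lemma 3.4
of the paper taken as a hypothesis** (`FordP1.Lemma34Hyp`, verbatim, at the `k` in question and all
`ω ∈ [1/(3 log k), 1/2]`), by the kernel re-run of PROGRAM 1 (`FordProgram1.lean`,
`FordProgram1Run*.lean`), with `ρ` exactly as printed and `θ = 2.4191, 2.3856, 2.3296` (the printed
`θ` rest on an exponent slip in PROGRAM 1, see `FordProgram1.lean`; a slightly larger `θ` is equally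
usable downstream, cf. the constant condition of `FordVK.sec5_interval`). The rows for `k ≥ 1191`
follow from Lemma 3.5 by the closed form `FordL36.row_of_lemma35_data` (`FordTheorem3RowLargeK.lean`).

* `FordP1.checkT_all` — `checkT k = true` for all `129 ≤ k ≤ 1190` (from the runs);
* `FordP1.row_129_149`, `FordP1.row_150_199`, `FordP1.row_200_1190` — **the rows**.

## References

* K. Ford, Proc. London Math. Soc. (3) 85 (2002), 565–633; arXiv:1910.08209: Theorem 3, (1.7),
  Lemmas 3.4–3.5, proof of Theorem 3, Appendix "PROGRAM 1". [Ford2002]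
-/

open Finset Real

namespace Literature.NumberTheory.LFunctions
namespace FordP1

/-- Auxiliary step (elementary consequence of the definitions). [folklore] -/
theorem checkT_of_all {a n k : ℕ} (h : ((List.range' a n).all checkT) = true) (hk : a ≤ k)
    (hk2 : k < a + n) : checkT k = true := by
  rw [List.all_eq_true] at h
  exact h k (List.mem_range'_1.mpr ⟨hk, hk2⟩)

/-- **`checkT k` holds for every `129 ≤ k ≤ 1190`** (assembly of the kernel runs). [cite: Ford2002,
Theorem 3 (second part) and PROGRAM 1] -/
theorem checkT_all {k : ℕ} (h1 : 129 ≤ k) (h2 : k ≤ 1190) : checkT k = true := by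
  rcases lt_or_ge k 225 with h | h1
  · exact checkT_of_all run01 (by omega) h
  rcases lt_or_ge k 291 with h | h2
  · exact checkT_of_all run02 (by omega) h
  rcases lt_or_ge k 310 with h | h3
  · exact run03A k (by omega) (by omega)
  rcases lt_or_ge k 328 with h | h4
  · exact run03B k (by omega) (by omega)
  rcases lt_or_ge k 344 with h | h5
  · exact run03C k (by omega) (by omega)
  rcases lt_or_ge k 360 with h | h6
  · exact run04A k (by omega) (by omega)
  rcases lt_or_ge k 376 with h | h7
  · exact run04B k (by omega) (by omega)
  rcases lt_or_ge k 390 with h | h8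
  · exact run04C k (by omega) (by omega)
  rcases lt_or_ge k 431 with h | h9
  · exact checkT_of_all run05 (by omega) h
  rcases lt_or_ge k 468 with h | h10
  · exact checkT_of_all run06 (by omega) h
  rcases lt_or_ge k 480 with h | h11
  · exact run07A k (by omega) (by omega)
  rcases lt_or_ge k 492 with h | h12
  · exact run07B k (by omega) (by omega)
  rcases lt_or_ge k 503 with h | h13
  · exact run07C k (by omega) (by omega)
  rcases lt_or_ge k 514 with h | h14
  · exact run08A k (by omega) (by omega)
  rcases lt_or_ge k 525 with h | h15
  · exact run08B k (by omega) (by omega)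
  rcases lt_or_ge k 535 with h | h16
  · exact run08C k (by omega) (by omega)
  rcases lt_or_ge k 565 with h | h17
  · exact checkT_of_all run09 (by omega) h
  rcases lt_or_ge k 594 with h | h18
  · exact checkT_of_all run10 (by omega) h
  rcases lt_or_ge k 604 with h | h19
  · exact run11A k (by omega) (by omega)
  rcases lt_or_ge k 613 with h | h20
  · exact run11B k (by omega) (by omega)
  rcases lt_or_ge k 621 with h | h21
  · exact run11C k (by omega) (by omega)
  rcases lt_or_ge k 630 with h | h22
  · exact run12A k (by omega) (by omega)
  rcases lt_or_ge k 639 with h | h23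
  · exact run12B k (by omega) (by omega)
  rcases lt_or_ge k 647 with h | h24
  · exact run12C k (by omega) (by omega)
  rcases lt_or_ge k 656 with h | h25
  · exact run13A k (by omega) (by omega)
  rcases lt_or_ge k 665 with h | h26
  · exact run13B k (by omega) (by omega)
  rcases lt_or_ge k 672 with h | h27
  · exact run13C k (by omega) (by omega)
  rcases lt_or_ge k 681 with h | h28
  · exact run14A k (by omega) (by omega)
  rcases lt_or_ge k 689 with h | h29
  · exact run14B k (by omega) (by omega)
  rcases lt_or_ge k 696 with h | h30
  · exact run14C k (by omega) (by omega)
  rcases lt_or_ge k 705 with h | h31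
  · exact run15A k (by omega) (by omega)
  rcases lt_or_ge k 713 with h | h32
  · exact run15B k (by omega) (by omega)
  rcases lt_or_ge k 720 with h | h33
  · exact run15C k (by omega) (by omega)
  rcases lt_or_ge k 743 with h | h34
  · exact checkT_of_all run16 (by omega) h
  rcases lt_or_ge k 765 with h | h35
  · exact checkT_of_all run17 (by omega) h
  rcases lt_or_ge k 786 with h | h36
  · exact checkT_of_all run18 (by omega) h
  rcases lt_or_ge k 794 with h | h37
  · exact run19A k (by omega) (by omega)
  rcases lt_or_ge k 801 with h | h38
  · exact run19B k (by omega) (by omega)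
  rcases lt_or_ge k 807 with h | h39
  · exact run19C k (by omega) (by omega)
  rcases lt_or_ge k 814 with h | h40
  · exact run20A k (by omega) (by omega)
  rcases lt_or_ge k 821 with h | h41
  · exact run20B k (by omega) (by omega)
  rcases lt_or_ge k 827 with h | h42
  · exact run20C k (by omega) (by omega)
  rcases lt_or_ge k 847 with h | h43
  · exact checkT_of_all run21 (by omega) h
  rcases lt_or_ge k 866 with h | h44
  · exact checkT_of_all run22 (by omega) h
  rcases lt_or_ge k 873 with h | h45
  · exact run23A k (by omega) (by omega)
  rcases lt_or_ge k 880 with h | h46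
  · exact run23B k (by omega) (by omega)
  rcases lt_or_ge k 885 with h | h47
  · exact run23C k (by omega) (by omega)
  rcases lt_or_ge k 892 with h | h48
  · exact run24A k (by omega) (by omega)
  rcases lt_or_ge k 899 with h | h49
  · exact run24B k (by omega) (by omega)
  rcases lt_or_ge k 904 with h | h50
  · exact run24C k (by omega) (by omega)
  rcases lt_or_ge k 911 with h | h51
  · exact run25A k (by omega) (by omega)
  rcases lt_or_ge k 917 with h | h52
  · exact run25B k (by omega) (by omega)
  rcases lt_or_ge k 922 with h | h53
  · exact run25C k (by omega) (by omega)
  rcases lt_or_ge k 940 with h | h54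
  · exact checkT_of_all run26 (by omega) h
  rcases lt_or_ge k 946 with h | h55
  · exact run27A k (by omega) (by omega)
  rcases lt_or_ge k 952 with h | h56
  · exact run27B k (by omega) (by omega)
  rcases lt_or_ge k 957 with h | h57
  · exact run27C k (by omega) (by omega)
  rcases lt_or_ge k 974 with h | h58
  · exact checkT_of_all run28 (by omega) h
  rcases lt_or_ge k 980 with h | h59
  · exact run29A k (by omega) (by omega)
  rcases lt_or_ge k 986 with h | h60
  · exact run29B k (by omega) (by omega)
  rcases lt_or_ge k 991 with h | h61
  · exact run29C k (by omega) (by omega)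
  rcases lt_or_ge k 997 with h | h62
  · exact run30A k (by omega) (by omega)
  rcases lt_or_ge k 1003 with h | h63
  · exact run30B k (by omega) (by omega)
  rcases lt_or_ge k 1008 with h | h64
  · exact run30C k (by omega) (by omega)
  rcases lt_or_ge k 1014 with h | h65
  · exact run31A k (by omega) (by omega)
  rcases lt_or_ge k 1020 with h | h66
  · exact run31B k (by omega) (by omega)
  rcases lt_or_ge k 1024 with h | h67
  · exact run31C k (by omega) (by omega)
  rcases lt_or_ge k 1030 with h | h68
  · exact run32A k (by omega) (by omega)
  rcases lt_or_ge k 1036 with h | h69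
  · exact run32B k (by omega) (by omega)
  rcases lt_or_ge k 1040 with h | h70
  · exact run32C k (by omega) (by omega)
  rcases lt_or_ge k 1056 with h | h71
  · exact checkT_of_all run33 (by omega) h
  rcases lt_or_ge k 1062 with h | h72
  · exact run34A k (by omega) (by omega)
  rcases lt_or_ge k 1067 with h | h73
  · exact run34B k (by omega) (by omega)
  rcases lt_or_ge k 1071 with h | h74
  · exact run34C k (by omega) (by omega)
  rcases lt_or_ge k 1086 with h | h75
  · exact checkT_of_all run35 (by omega) h
  rcases lt_or_ge k 1092 with h | h76
  · exact run36A k (by omega) (by omega)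
  rcases lt_or_ge k 1097 with h | h77
  · exact run36B k (by omega) (by omega)
  rcases lt_or_ge k 1101 with h | h78
  · exact run36C k (by omega) (by omega)
  rcases lt_or_ge k 1107 with h | h79
  · exact run37A k (by omega) (by omega)
  rcases lt_or_ge k 1112 with h | h80
  · exact run37B k (by omega) (by omega)
  rcases lt_or_ge k 1116 with h | h81
  · exact run37C k (by omega) (by omega)
  rcases lt_or_ge k 1122 with h | h82
  · exact run38A k (by omega) (by omega)
  rcases lt_or_ge k 1127 with h | h83
  · exact run38B k (by omega) (by omega)
  rcases lt_or_ge k 1131 with h | h84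
  · exact run38C k (by omega) (by omega)
  rcases lt_or_ge k 1136 with h | h85
  · exact run39A k (by omega) (by omega)
  rcases lt_or_ge k 1141 with h | h86
  · exact run39B k (by omega) (by omega)
  rcases lt_or_ge k 1145 with h | h87
  · exact run39C k (by omega) (by omega)
  rcases lt_or_ge k 1150 with h | h88
  · exact run40A k (by omega) (by omega)
  rcases lt_or_ge k 1155 with h | h89
  · exact run40B k (by omega) (by omega)
  rcases lt_or_ge k 1159 with h | h90
  · exact run40C k (by omega) (by omega)
  rcases lt_or_ge k 1173 with h | h91
  · exact checkT_of_all run41 (by omega) h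
  exact checkT_of_all run42 (by omega) (by omega)

/-- The row from `checkT`. [cite: Ford2002, Theorem 3, (1.7)] -/
theorem row_of_checkT {k : ℕ} (h : checkT k = true)
    (hL34 : ∀ ω : ℝ, 1 / (3 * Real.log k) ≤ ω → ω ≤ 1 / 2 → Lemma34Hyp k ω) :
    ∃ s : ℕ, 1 ≤ s ∧ (s : ℝ) ≤ (rhoOf k : ℝ) / 100000 * (k : ℝ) ^ 2 ∧
      ∀ P : ℕ, 1 ≤ P → (VMV.J k s (Finset.Icc (1 : ℤ) P) : ℝ) ≤
        (k : ℝ) ^ ((thetaOf k : ℝ) / 10000 * (k : ℝ) ^ 3) *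
          (P : ℝ) ^ ((2 * (s : ℝ)) - ((k * (k + 1) / 2 : ℕ) : ℝ) + 0.001 * (k : ℝ) ^ 2) :=
  row_of_checkK h hL34

/-- **Theorem 3, row `129 ≤ k ≤ 149` of (1.7)** (`ρ = 3.22313`, `θ = 2.4191`), from Lemma 3.4.
[cite: Ford2002, Theorem 3, (1.7)] -/
theorem row_129_149 {k : ℕ} (h1 : 129 ≤ k) (h2 : k ≤ 149)
    (hL34 : ∀ ω : ℝ, 1 / (3 * Real.log k) ≤ ω → ω ≤ 1 / 2 → Lemma34Hyp k ω) :
    ∃ s₃ : ℕ, 1 ≤ s₃ ∧ (s₃ : ℝ) ≤ 3.22313 * (k : ℝ) ^ 2 ∧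
      ∀ P : ℕ, 1 ≤ P → (VMV.J k s₃ (Finset.Icc (1 : ℤ) P) : ℝ) ≤
        (k : ℝ) ^ ((2.4191 : ℝ) * (k : ℝ) ^ 3) *
          (P : ℝ) ^ ((2 * s₃ : ℝ) - ((k * (k + 1) / 2 : ℕ) : ℝ) + 0.001 * (k : ℝ) ^ 2) := by
  obtain ⟨s, hs1, hs2, hs3⟩ := row_of_checkT (checkT_all h1 (by omega)) hL34
  have hr : rhoOf k = 322313 := by unfold rhoOf; rw [if_neg (by omega), if_neg (by omega)]
  have ht : thetaOf k = 24191 := by unfold thetaOf; rw [if_neg (by omega), if_neg (by omega)]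
  rw [hr] at hs2; rw [ht] at hs3
  refine ⟨s, hs1, by norm_num at hs2 ⊢; linarith, fun P hP => ?_⟩
  have := hs3 P hP
  norm_num at this ⊢
  exact this

/-- **Theorem 3, row `150 ≤ k ≤ 199` of (1.7)** (`ρ = 3.21734`, `θ = 2.3856`), from Lemma 3.4.
[cite: Ford2002, Theorem 3, (1.7)] -/
theorem row_150_199 {k : ℕ} (h1 : 150 ≤ k) (h2 : k ≤ 199)
    (hL34 : ∀ ω : ℝ, 1 / (3 * Real.log k) ≤ ω → ω ≤ 1 / 2 → Lemma34Hyp k ω) :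
    ∃ s₃ : ℕ, 1 ≤ s₃ ∧ (s₃ : ℝ) ≤ 3.21734 * (k : ℝ) ^ 2 ∧
      ∀ P : ℕ, 1 ≤ P → (VMV.J k s₃ (Finset.Icc (1 : ℤ) P) : ℝ) ≤
        (k : ℝ) ^ ((2.3856 : ℝ) * (k : ℝ) ^ 3) *
          (P : ℝ) ^ ((2 * s₃ : ℝ) - ((k * (k + 1) / 2 : ℕ) : ℝ) + 0.001 * (k : ℝ) ^ 2) := by
  obtain ⟨s, hs1, hs2, hs3⟩ := row_of_checkT (checkT_all (by omega) (by omega)) hL34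
  have hr : rhoOf k = 321734 := by unfold rhoOf; rw [if_neg (by omega), if_pos (by omega)]
  have ht : thetaOf k = 23856 := by unfold thetaOf; rw [if_neg (by omega), if_pos (by omega)]
  rw [hr] at hs2; rw [ht] at hs3
  refine ⟨s, hs1, by norm_num at hs2 ⊢; linarith, fun P hP => ?_⟩
  have := hs3 P hP
  norm_num at this ⊢
  exact this

/-- **Theorem 3, row `200 ≤ k ≤ 1190` of (1.7)** (`ρ = 3.21432`, `θ = 2.3296`), from Lemma 3.4.
[cite: Ford2002, Theorem 3, (1.7)] -/
theorem row_200_1190 {k : ℕ} (h1 : 200 ≤ k) (h2 : k ≤ 1190)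
    (hL34 : ∀ ω : ℝ, 1 / (3 * Real.log k) ≤ ω → ω ≤ 1 / 2 → Lemma34Hyp k ω) :
    ∃ s₃ : ℕ, 1 ≤ s₃ ∧ (s₃ : ℝ) ≤ 3.21432 * (k : ℝ) ^ 2 ∧
      ∀ P : ℕ, 1 ≤ P → (VMV.J k s₃ (Finset.Icc (1 : ℤ) P) : ℝ) ≤
        (k : ℝ) ^ ((2.3296 : ℝ) * (k : ℝ) ^ 3) *
          (P : ℝ) ^ ((2 * s₃ : ℝ) - ((k * (k + 1) / 2 : ℕ) : ℝ) + 0.001 * (k : ℝ) ^ 2) := by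
  obtain ⟨s, hs1, hs2, hs3⟩ := row_of_checkT (checkT_all (by omega) h2) hL34
  have hr : rhoOf k = 321432 := by unfold rhoOf; rw [if_pos (by omega)]
  have ht : thetaOf k = 23296 := by unfold thetaOf; rw [if_pos (by omega)]
  rw [hr] at hs2; rw [ht] at hs3
  refine ⟨s, hs1, by norm_num at hs2 ⊢; linarith, fun P hP => ?_⟩
  have := hs3 P hP
  norm_num at this ⊢
  exact this

end FordP1
end Literature.NumberTheory.LFunctions
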